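import Mathlib
import Literature.Computability.AlgebraicComplexity.EquivariantDC
import Literature.Computability.AlgebraicComplexity.StandardFamilies
import Summits.ValiantsHypothesis.ValiantsHypothesis.Theorems.SymPencilEquivariantSdcNotQPPermifyReduction
import Summits.ValiantsHypothesis.ValiantsHypothesis.Theorems.SymPencilEquivariantSdcNotQPPermEmbeddingRegular
import Summits.ValiantsHypothesis.ValiantsHypothesis.Theorems.SymPencilEquivariantSdcNotQPPermEmbeddingOfFunctionals
import Summits.ValiantsHypothesis.ValiantsHypothesis.Theorems.SymPencilSymmetrizePermPairsConjugationNormalFormSub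
import Summits.ValiantsHypothesis.ValiantsHypothesis.Theorems.SymPencilSymmetrizePermPairsFiniteConjugationLiftSub
import HarnessLib

/-!
# ValiantsHypothesis / SymPencil — crux `SymmetrizePermPairs` (stmt-ValiantsHypothesis-17793),
# line `Cruxes/SdcThesis/Lines/birth_SymmetrizePermPairs.lean`, stub `stub_induce`, piece (I2):
# REGULAR PERMIFY FOR A SUBGROUP `H ≤ 𝔖_n × 𝔖_n`

Piece (I2) of the tenure's sizing of `stub_induce` («regular-permify case», note
`NOTE-p7g11-17793-stub_induce-sizing.md`): an affine determinantal representation `A` of `per_n` of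
size `m`, equivariant (exact `GL_m × GL_m` lifts) under the subgroup of `GL(n², ℂ)` generated by the
permutation matrices of the pairs of a SUBGROUP `H ≤ 𝔖_n × 𝔖_n`, can be replaced by an affine pencil
`A'` of size `m' ≤ m² · |H|` with `det A' = per_n` on which every substitution
`x_{ij} ↦ x_{π i, ρ j}`, `(π, ρ) ∈ H`, is undone by conjugation with a PERMUTATION matrix
(`permify_regular_of_subgroup`).  When `|H| ≤ 2^{(log₂ [𝔖_n × 𝔖_n : H])²}` — in particular whenever
the index `R` of `H` satisfies `(n!)² ≤ 2^{(log₂ R)²}`, i.e. `R ≥ 2^{√(2 log₂ n!)}` — this is within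
the quasi-polynomial budget `2^{(log₂ (m R + m) + 2)²}` of `stub_induce` (`permify_regular_of_subgroup_qp`,
`d = 2`).  The small-index regime (cores (C1)–(C3) of the note) is NOT touched.

Chain (the `stub_permify` chain of the closed sister crux `EquivariantSdcNotQP`, re-run for `H`):
(i) `conjugationNormalForm_rename_sub`; (ii) `finiteConjugationLift_sub` (lift group `F`, then
`F' = F ∩ (H × GL)`, of order `≤ m₀ · |H|`: `card_liftGroup_le_of_fst_mem`); (iii) the regular
embedding of `ℂ^{m₀}` into the permutation module `⊔_{k < m₀} F'` via
`PermEmbedding.permEmbedding_of_invariant_functionals` with trivial stabilisers and the coordinate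
functionals (`permEmbedding_regular_sub`, `m' = m₀ · |F'|`); (iv) `exists_permConj_extension`.

Honest framing: helper layer for an OPEN stub (`stub_induce`) of an OPEN crux (`SymmetrizePermPairs`);
nothing here is the registered stub; `VP ≠ VNP` is NOT proved and nothing here is progress on it.
No new definitions, no named facts (`--supports stmt-ValiantsHypothesis-17793 --as helper`).
-/

noncomputable section

-- `Summit.ValiantsHypothesis.ValiantsHypothesis.…` is the tree's mandated single-conjunct layout
-- (Sub = Summit), so the duplicated namespace component is intended.
set_option linter.dupNamespace false

namespace Summit.ValiantsHypothesis.ValiantsHypothesis.Theorems.SymPencilEquivariantSdcNotQP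

open Literature.Computability.AlgebraicComplexity MvPolynomial Matrix

/-! ### The lift group over a subgroup of pairs is small -/

/-- **Order of a lift group over `H`.**  A subgroup `F ≤ (𝔖_n × 𝔖_n) × GL_{m₀}(ℂ)` (`m₀ ≥ 1`)
with scalar unimodular fibre over `(1,1)` whose pair components lie in `H ≤ 𝔖_n × 𝔖_n` is finite of
order `≤ m₀ · |H|`: the fibre embeds into the `m₀`-th roots of unity and the image into `H`
(cf. `PermEmbedding.card_liftGroup_le`, the case `H = ⊤`). [folklore] -/
theorem card_liftGroup_le_of_fst_mem {n m₀ : ℕ} (hm₀ : 1 ≤ m₀)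
    (H : Subgroup (Equiv.Perm (Fin n) × Equiv.Perm (Fin n)))
    (F : Subgroup ((Equiv.Perm (Fin n) × Equiv.Perm (Fin n)) × GL (Fin m₀) ℂ))
    (hscal : ∀ g : GL (Fin m₀) ℂ, ((1 : Equiv.Perm (Fin n) × Equiv.Perm (Fin n)), g) ∈ F →
      ∃ c : ℂ, (g : Matrix (Fin m₀) (Fin m₀) ℂ) = c • (1 : Matrix (Fin m₀) (Fin m₀) ℂ))
    (hdet : ∀ x ∈ F, Matrix.det (x.2 : Matrix (Fin m₀) (Fin m₀) ℂ) = 1)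
    (hFH : ∀ x ∈ F, x.1 ∈ H) :
    Finite F ∧ Nat.card F ≤ m₀ * Nat.card H := by
  classical
  let f : F →* Equiv.Perm (Fin n) × Equiv.Perm (Fin n) :=
    (MonoidHom.fst _ (GL (Fin m₀) ℂ)).comp F.subtype
  have hf : ∀ x : F, f x = ((x : (Equiv.Perm (Fin n) × Equiv.Perm (Fin n)) × GL (Fin m₀) ℂ)).1 :=
    fun x => rfl
  -- kernel elements: scalar roots of unity
  have hker : ∀ x : F, x ∈ f.ker → ∃ c : ℂ, c ^ m₀ = 1 ∧
      (((x : (Equiv.Perm (Fin n) × Equiv.Perm (Fin n)) × GL (Fin m₀) ℂ)).2 :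
        Matrix (Fin m₀) (Fin m₀) ℂ) = c • (1 : Matrix (Fin m₀) (Fin m₀) ℂ) := by
    intro x hx
    rw [MonoidHom.mem_ker, hf] at hx
    exact PermEmbedding.fibre_scalar F hscal hdet _ x.2 hx
  let i₀ : Fin m₀ := ⟨0, hm₀⟩
  let ψ : f.ker → ↥(Polynomial.nthRootsFinset m₀ (1 : ℂ)) := fun x =>
    ⟨(((x : F) : (Equiv.Perm (Fin n) × Equiv.Perm (Fin n)) × GL (Fin m₀) ℂ).2 :
        Matrix (Fin m₀) (Fin m₀) ℂ) i₀ i₀, by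
      obtain ⟨c, hc, hx⟩ := hker x x.2
      rw [Polynomial.mem_nthRootsFinset hm₀, hx]
      simpa using hc⟩
  have hψ : Function.Injective ψ := by
    intro x y hxy
    obtain ⟨c, -, hx⟩ := hker x x.2
    obtain ⟨c', -, hy⟩ := hker y y.2
    have hcc : c = c' := by
      have h := congrArg Subtype.val hxy
      simp only [ψ, hx, hy, Matrix.smul_apply, Matrix.one_apply_eq, smul_eq_mul, mul_one] at h
      exact h
    have hx1 : (((x : F) : (Equiv.Perm (Fin n) × Equiv.Perm (Fin n)) × GL (Fin m₀) ℂ)).1 = 1 := by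
      rw [← hf]; exact (MonoidHom.mem_ker).mp x.2
    have hy1 : (((y : F) : (Equiv.Perm (Fin n) × Equiv.Perm (Fin n)) × GL (Fin m₀) ℂ)).1 = 1 := by
      rw [← hf]; exact (MonoidHom.mem_ker).mp y.2
    apply Subtype.ext
    apply Subtype.ext
    refine Prod.ext (hx1.trans hy1.symm) (Units.ext ?_)
    rw [hx, hy, hcc]
  have hker_fin : Finite f.ker := Finite.of_injective ψ hψ
  have hker_card : Nat.card f.ker ≤ m₀ := by
    refine (Nat.card_le_card_of_injective ψ hψ).trans ?_
    rw [Nat.card_eq_fintype_card, Fintype.card_coe, Polynomial.nthRootsFinset_def]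
    exact (Multiset.toFinset_card_le _).trans (Polynomial.card_nthRoots _ _)
  -- the image lies in `H`
  let θ : f.range → H := fun y => ⟨(y : Equiv.Perm (Fin n) × Equiv.Perm (Fin n)), by
    obtain ⟨x, hx⟩ := y.2
    rw [← hx, hf]
    exact hFH _ x.2⟩
  have hθ : Function.Injective θ := by
    intro y y' h
    apply Subtype.ext
    have h' := congrArg Subtype.val h
    exact h'
  have hrange_card : Nat.card f.range ≤ Nat.card H := Nat.card_le_card_of_injective θ hθ
  have hcard : Nat.card F = Nat.card f.range * Nat.card f.ker := by
    rw [← Subgroup.index_ker, Subgroup.index_mul_card]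
  have hrange_pos : 0 < Nat.card f.range := Nat.card_pos
  have hker_pos : 0 < Nat.card f.ker := Nat.card_pos
  refine ⟨Nat.finite_of_card_ne_zero ?_, ?_⟩
  · rw [hcard]; exact Nat.mul_ne_zero hrange_pos.ne' hker_pos.ne'
  · rw [hcard, mul_comm]
    exact Nat.mul_le_mul hker_card hrange_card

/-! ### Step (iii) at cost `m₀² · |H|`: the regular embedding over `H` -/

/-- **Permutation embedding over a subgroup of pairs.**  For a lift group
`F ≤ (𝔖_n × 𝔖_n) × GL_{m₀}(ℂ)` with scalar unimodular fibre over `(1,1)` and pair components in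
`H ≤ 𝔖_n × 𝔖_n`, the `F`-module `ℂ^{m₀}` is an equivariant retract (`p ι = 1`, `P_τ ι = ι g`,
`p P_τ = g p`) of a PERMUTATION `F`-module of dimension `m' ≤ m₀² · |H|` — the cosets
`⊔_{k < m₀} F/1` (`PermEmbedding.permEmbedding_of_invariant_functionals` with trivial stabilisers and
the coordinate functionals `e_k`, which separate `ℂ^{m₀}` already at `x = 1`). [folklore] -/
theorem permEmbedding_regular_sub (n m₀ : ℕ)
    (H : Subgroup (Equiv.Perm (Fin n) × Equiv.Perm (Fin n)))
    (F : Subgroup ((Equiv.Perm (Fin n) × Equiv.Perm (Fin n)) × GL (Fin m₀) ℂ))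
    (hscal : ∀ g : GL (Fin m₀) ℂ, ((1 : Equiv.Perm (Fin n) × Equiv.Perm (Fin n)), g) ∈ F →
      ∃ c : ℂ, (g : Matrix (Fin m₀) (Fin m₀) ℂ) = c • (1 : Matrix (Fin m₀) (Fin m₀) ℂ))
    (hdet : ∀ x ∈ F, Matrix.det (x.2 : Matrix (Fin m₀) (Fin m₀) ℂ) = 1)
    (hFH : ∀ x ∈ F, x.1 ∈ H) :
    ∃ m' ≤ m₀ ^ 2 * Nat.card H,
      ∃ (ι : Matrix (Fin m') (Fin m₀) ℂ) (p : Matrix (Fin m₀) (Fin m') ℂ)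
        (τ : (Equiv.Perm (Fin n) × Equiv.Perm (Fin n)) × GL (Fin m₀) ℂ → Equiv.Perm (Fin m')),
        p * ι = 1 ∧ ∀ x ∈ F,
          (τ x).permMatrix ℂ * ι = ι * (x.2 : Matrix (Fin m₀) (Fin m₀) ℂ) ∧
          p * (τ x).permMatrix ℂ = (x.2 : Matrix (Fin m₀) (Fin m₀) ℂ) * p := by
  classical
  rcases Nat.eq_zero_or_pos m₀ with rfl | hm₀
  · -- `m₀ = 0`: all matrices involved have a `Fin 0` side
    refine ⟨0, Nat.zero_le _, 0, 0, fun _ => 1, ?_, fun x _ => ⟨?_, ?_⟩⟩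
    · ext i; exact Fin.elim0 i
    · ext i; exact Fin.elim0 i
    · ext i; exact Fin.elim0 i
  obtain ⟨hfin, hcard⟩ := card_liftGroup_le_of_fst_mem hm₀ H F hscal hdet hFH
  -- trivial stabilisers, coordinate functionals
  have hw : ∀ k : Fin m₀, ∀ h ∈ (⊥ : Subgroup F), (Pi.single k (1 : ℂ)) ᵥ*
      (((h : (Equiv.Perm (Fin n) × Equiv.Perm (Fin n)) × GL (Fin m₀) ℂ).2 : GL (Fin m₀) ℂ) :
        Matrix (Fin m₀) (Fin m₀) ℂ) = Pi.single k 1 := by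
    intro k h hh
    rw [Subgroup.mem_bot] at hh
    rw [hh, Subgroup.coe_one, Prod.snd_one, Units.val_one, Matrix.vecMul_one]
  have hsep : ∀ v : Fin m₀ → ℂ,
      (∀ k : Fin m₀, ∀ x ∈ F, Pi.single k (1 : ℂ) ⬝ᵥ ((x.2 : Matrix (Fin m₀) (Fin m₀) ℂ) *ᵥ v) = 0) →
        v = 0 := by
    intro v hv
    funext k
    have h := hv k 1 F.one_mem
    rw [Prod.snd_one, Units.val_one, Matrix.one_mulVec, single_dotProduct, one_mul] at h
    exact h
  obtain ⟨m', hm', ι, p, τ, hpι, hrel⟩ :=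
    PermEmbedding.permEmbedding_of_invariant_functionals F hscal hdet (K := Fin m₀)
      (fun _ => (⊥ : Subgroup F)) (fun k => Pi.single k (1 : ℂ)) hw hsep
  refine ⟨m', ?_, ι, p, τ, hpι, hrel⟩
  rw [hm']
  simp only [Subgroup.index_bot, Finset.sum_const, Finset.card_univ, Fintype.card_fin,
    smul_eq_mul]
  calc m₀ * Nat.card F ≤ m₀ * (m₀ * Nat.card H) := Nat.mul_le_mul_left _ hcard
    _ = m₀ ^ 2 * Nat.card H := by ring

/-! ### Piece (I2): regular permify for a subgroup -/

/-- **Regular permify for a subgroup `H ≤ 𝔖_n × 𝔖_n`** (piece (I2) of `stub_induce`'s sizing).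
An affine determinantal representation `A` of `per_n` of size `m`, equivariant (exact `GL_m × GL_m`
lifts, tree `IsEquivariantDetRepr`) under the subgroup of `GL(n², ℂ)` generated by the permutation
matrices of the pairs in `H`, yields an affine pencil `A'` of size `m' ≤ m² · |H|` with
`det A' = per_n` on which every substitution `x_{ij} ↦ x_{π i, ρ j}`, `(π, ρ) ∈ H`, is undone by
conjugation with a PERMUTATION matrix: `A'(x_{π i, ρ j}) = P_σ A'(x) P_σᵀ`.  Steps:
(i) `conjugationNormalForm_rename_sub`, (ii) `finiteConjugationLift_sub` (lift group cut down to
`F ∩ (H × GL)`), (iii) `permEmbedding_regular_sub`, (iv) `exists_permConj_extension`.  For `H = ⊤`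
this is `permify_exponential_of_finiteLift` (`m² (n!)²`). [folklore] -/
theorem permify_regular_of_subgroup (n m : ℕ)
    (H : Subgroup (Equiv.Perm (Fin n) × Equiv.Perm (Fin n)))
    (A : Matrix (Fin m) (Fin m) (MvPolynomial (Fin n × Fin n) ℂ))
    (hA : IsEquivariantDetRepr (Subgroup.closure {γ : GL (Fin n × Fin n) ℂ |
        ∃ πρ ∈ H, (γ : Matrix (Fin n × Fin n) (Fin n × Fin n) ℂ) =
          Equiv.Perm.permMatrix ℂ (Equiv.prodCongr πρ.1 πρ.2)}) (perPoly (Fin n) ℂ) A) :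
    ∃ m' ≤ m ^ 2 * Nat.card H,
      ∃ A' : Matrix (Fin m') (Fin m') (MvPolynomial (Fin n × Fin n) ℂ),
        IsAffineDetRepr (perPoly (Fin n) ℂ) A' ∧
        ∀ πρ ∈ H, ∃ σ : Equiv.Perm (Fin m'),
          A'.map (MvPolynomial.rename fun ij : Fin n × Fin n => (πρ.1 ij.1, πρ.2 ij.2)) =
            (σ.permMatrix ℂ).map MvPolynomial.C * A' * ((σ.permMatrix ℂ)ᵀ).map MvPolynomial.C := by
  classical
  -- step (i): conjugation normal form, `rename` form, over `H`
  obtain ⟨B, hB, hBJ, hgen⟩ := conjugationNormalForm_rename_sub n m H A hA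
  -- step (ii): finite conjugation lift over `H`
  obtain ⟨m₀, hm₀, B₀, F, hB₀, hsurj, hscal, hdet, hliftF⟩ :=
    finiteConjugationLift_sub n m H B hB hBJ hgen
  -- cut the lift group down to the pairs of `H`
  obtain ⟨F', hmemF'⟩ :
      ∃ F' : Subgroup ((Equiv.Perm (Fin n) × Equiv.Perm (Fin n)) × GL (Fin m₀) ℂ),
        ∀ x, x ∈ F' ↔ x ∈ F ∧ x.1 ∈ H :=
    ⟨F ⊓ H.prod ⊤, fun x => by
      rw [Subgroup.mem_inf, Subgroup.mem_prod]
      simp only [Subgroup.mem_top, and_true]⟩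
  have hscal' : ∀ g : GL (Fin m₀) ℂ, ((1 : Equiv.Perm (Fin n) × Equiv.Perm (Fin n)), g) ∈ F' →
      ∃ c : ℂ, (g : Matrix (Fin m₀) (Fin m₀) ℂ) = c • (1 : Matrix (Fin m₀) (Fin m₀) ℂ) :=
    fun g hg => hscal g ((hmemF' _).mp hg).1
  have hdet' : ∀ x ∈ F', Matrix.det (x.2 : Matrix (Fin m₀) (Fin m₀) ℂ) = 1 :=
    fun x hx => hdet x ((hmemF' _).mp hx).1
  have hF'H : ∀ x ∈ F', x.1 ∈ H := fun x hx => ((hmemF' _).mp hx).2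
  -- step (iii): the regular embedding over `H`
  obtain ⟨m', hm', ι, p, τ, hpι, hrel⟩ := permEmbedding_regular_sub n m₀ H F' hscal' hdet' hF'H
  -- step (iv): extension by the identity, substitutions indexed by `H`
  obtain ⟨A', hA'deg, hA'det, hA'perm⟩ := exists_permConj_extension
    (fun πρ : H =>
      MvPolynomial.rename fun ij : Fin n × Fin n =>
        ((πρ : Equiv.Perm (Fin n) × Equiv.Perm (Fin n)).1 ij.1,
          (πρ : Equiv.Perm (Fin n) × Equiv.Perm (Fin n)).2 ij.2))
    B₀ hB₀.1 ι p hpι (fun πρ => by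
      obtain ⟨g, hg⟩ := hsurj πρ πρ.2
      have hg' : ((πρ : Equiv.Perm (Fin n) × Equiv.Perm (Fin n)), g) ∈ F' :=
        (hmemF' _).mpr ⟨hg, πρ.2⟩
      -- explicit arguments (no `_`): unifying the lift identity against a metavariable
      -- pair makes the unifier unfold `rename` (heartbeat timeout)
      exact ⟨g, τ ((πρ : Equiv.Perm (Fin n) × Equiv.Perm (Fin n)), g),
        hliftF ((πρ : Equiv.Perm (Fin n) × Equiv.Perm (Fin n)), g) hg,
        (hrel ((πρ : Equiv.Perm (Fin n) × Equiv.Perm (Fin n)), g) hg').1,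
        (hrel ((πρ : Equiv.Perm (Fin n) × Equiv.Perm (Fin n)), g) hg').2⟩)
  refine ⟨m', ?_, A', ⟨hA'deg, hA'det.trans hB₀.2⟩, fun πρ hπρ => hA'perm ⟨πρ, hπρ⟩⟩
  calc m' ≤ m₀ ^ 2 * Nat.card H := hm'
    _ ≤ m ^ 2 * Nat.card H := Nat.mul_le_mul_right _ (Nat.pow_le_pow_left hm₀ 2)

/-! ### The budget of `stub_induce` in the large-index regime -/

/-- Arithmetic of the (I2) budget: `N ≤ 2^{(log₂ R)²}` gives `m² N ≤ 2^{(log₂ (m R + m) + 2)²}`.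
[folklore] -/
theorem regular_budget (m R N : ℕ) (hN : N ≤ 2 ^ ((Nat.log 2 R) ^ 2)) :
    m ^ 2 * N ≤ 2 ^ ((Nat.log 2 (m * R + m) + 2) ^ 2) := by
  rcases Nat.eq_zero_or_pos m with rfl | hm
  · simp
  set L := Nat.log 2 (m * R + m) with hL
  have hRL : Nat.log 2 R ≤ L := by
    refine Nat.log_mono_right ?_
    calc R = 1 * R := (one_mul R).symm
      _ ≤ m * R := Nat.mul_le_mul_right _ hm
      _ ≤ m * R + m := Nat.le_add_right _ _
  have hmL : Nat.log 2 m ≤ L := Nat.log_mono_right (Nat.le_add_left _ _)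
  have hm2 : m ≤ 2 ^ (L + 1) :=
    (Nat.lt_pow_succ_log_self Nat.one_lt_two m).le.trans
      (Nat.pow_le_pow_right (by norm_num) (by omega))
  have hN' : N ≤ 2 ^ (L ^ 2) :=
    hN.trans (Nat.pow_le_pow_right (by norm_num) (Nat.pow_le_pow_left hRL 2))
  calc m ^ 2 * N ≤ (2 ^ (L + 1)) ^ 2 * 2 ^ (L ^ 2) :=
        Nat.mul_le_mul (Nat.pow_le_pow_left hm2 2) hN'
    _ = 2 ^ (2 * (L + 1) + L ^ 2) := by rw [← pow_mul, ← pow_add, Nat.mul_comm (L + 1) 2]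
    _ ≤ 2 ^ ((L + 2) ^ 2) := Nat.pow_le_pow_right (by norm_num) (by nlinarith)

/-- **(I2) within the budget of `stub_induce`.**  In the currency of the registered stub
(`m' ≤ 2^{(log₂ (m·R + m) + d)^d}`, `R` the index): if `|H| ≤ 2^{(log₂ [𝔖_n × 𝔖_n : H])²}` — which
holds for every `H` of index `R` with `(n!)² ≤ 2^{(log₂ R)²}` since `|H| · R = (n!)²` — then the
regular permify `permify_regular_of_subgroup` costs `m' ≤ 2^{(log₂ (m R + m) + 2)²}`, i.e. the
exponent `d = 2`.  The complementary small-index regime is the open core of `stub_induce`.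
[folklore] -/
theorem permify_regular_of_subgroup_qp (n m : ℕ)
    (H : Subgroup (Equiv.Perm (Fin n) × Equiv.Perm (Fin n)))
    (hH : Nat.card H ≤ 2 ^ ((Nat.log 2 H.index) ^ 2))
    (A : Matrix (Fin m) (Fin m) (MvPolynomial (Fin n × Fin n) ℂ))
    (hA : IsEquivariantDetRepr (Subgroup.closure {γ : GL (Fin n × Fin n) ℂ |
        ∃ πρ ∈ H, (γ : Matrix (Fin n × Fin n) (Fin n × Fin n) ℂ) =
          Equiv.Perm.permMatrix ℂ (Equiv.prodCongr πρ.1 πρ.2)}) (perPoly (Fin n) ℂ) A) :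
    ∃ m' ≤ 2 ^ ((Nat.log 2 (m * H.index + m) + 2) ^ 2),
      ∃ A' : Matrix (Fin m') (Fin m') (MvPolynomial (Fin n × Fin n) ℂ),
        IsAffineDetRepr (perPoly (Fin n) ℂ) A' ∧
        ∀ πρ ∈ H, ∃ σ : Equiv.Perm (Fin m'),
          A'.map (MvPolynomial.rename fun ij : Fin n × Fin n => (πρ.1 ij.1, πρ.2 ij.2)) =
            (σ.permMatrix ℂ).map MvPolynomial.C * A' * ((σ.permMatrix ℂ)ᵀ).map MvPolynomial.C := by
  obtain ⟨m', hm', A', hA', hperm⟩ := permify_regular_of_subgroup n m H A hA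
  exact ⟨m', hm'.trans (regular_budget m H.index (Nat.card H) hH), A', hA', hperm⟩

/-- The large-index regime in terms of `n`: if `(n!)² ≤ 2^{(log₂ [𝔖_n × 𝔖_n : H])²}` then
`|H| ≤ 2^{(log₂ [𝔖_n × 𝔖_n : H])²}` (as `|H| ≤ |𝔖_n × 𝔖_n| = (n!)²`), so
`permify_regular_of_subgroup_qp` applies. [folklore] -/
theorem card_le_budget_of_factorial_sq_le {n : ℕ}
    (H : Subgroup (Equiv.Perm (Fin n) × Equiv.Perm (Fin n)))
    (hbig : (Nat.factorial n) ^ 2 ≤ 2 ^ ((Nat.log 2 H.index) ^ 2)) :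
    Nat.card H ≤ 2 ^ ((Nat.log 2 H.index) ^ 2) := by
  refine le_trans ?_ hbig
  calc Nat.card H ≤ Nat.card (Equiv.Perm (Fin n) × Equiv.Perm (Fin n)) :=
        Subgroup.card_le_card_group H
    _ = (Nat.factorial n) ^ 2 := by
        rw [Nat.card_prod, Nat.card_eq_fintype_card, Fintype.card_perm, Fintype.card_fin, sq]

end Summit.ValiantsHypothesis.ValiantsHypothesis.Theorems.SymPencilEquivariantSdcNotQP

end
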